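import Mathlib
import HarnessLib
import HarnessLib.Audit
import Summits.CriticalPhenomena.Statement
import Literature.Probability.Percolation.HalfSpacePinnedPairs
import Literature.Probability.Percolation.ConnectivityThetaSqProofs

/-!
Route: PercLowPointHalfSpace

It suffices to show X_LP [boundary-exponent bounds for the a.s.-FINITE critical half-space cluster +
the low-point bookkeeping; card
CriticalPhenomena/PercolationContinuityZ3/lowpoint-identity-halfspace-pinned-pairs]: with H = {x ∈
ℤ³ | x₀ ≥ 0}, P = P_{p_c(ℤ³)}, U = C_H(0) the open cluster of the floor point 0 in the induced
half-space graph (a.s. finite at p_c: Barsky–Grimmett–Newman, in tree), e = (0,1,0), e₀ = (1,0,0),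
arm_H(x,r) = {C_H(x) reaches sup-distance ≥ r from x}, π_s(r) = P(arm_H(0,r)):
 (A) BoundaryTwoArmDecay: ∃ κ > 0, C: P(arm_H(0,r), arm_H(e,r), 0 ↮_H e) ≤ C r^{−5/2−κ} (two
DISJOINT tall wall clusters from adjacent floor roots; BK/Reimer ≈ r^{−1.95}; predicted and
saturation-forced a₂ = d = 3; MC 2.9–3.1);
 (B) TallClusterMassBound — CRUX OF RECORD: ∃ C: E[|U ∩ B_r| ; arm_H(0,r)] ≤ C r^{11/4} π_s(r) (tall
wall clusters are thin, m ≤ 11/4 < 3; real world m = d_f = 2.523; a θ(p_c) > 0 world has finite but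
DENSE wall clusters, m = 3 — the one item of the route a jump world violates); two-layer: B ⟸
TopShellOverlap ∧ WallArmLowerRegularity (kernel-checked shell-wise Cauchy–Schwarz composition,
registered stubs; split to be filed);
 (C) QuantitativeBGN: ∃ a > 0, C: π_s(r) ≤ C r^{−a} (a rate in BGN's θ_H(p_c) = 0; numerics a = x_s
≈ 0.975);
 (K) LowPointBookkeeping: A → B → C → [P_{p_c}(0 ↔ n e₀) → 0 along the normal axis] — the route's
step (3): by the LOW-POINT IDENTITY τ_p(0,w) = E_p[N_w(U)/|U ∩ ∂H|] (PROVED: lowPointIdentity), its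
floor/cross split by horizontal mass transport (PROVED: measure_openConn_eq_floor_add_cross) and the
floor case (PROVED: halfSpaceAxisDecay_proof) this is EXACTLY 'A ∧ B ∧ C ⇒ the cross-bush term
E_{p_c}[N^cross_{n e₀}(U)/|U ∩ ∂H|] → 0', which the bush/floor exponent count a₂ > 2m − 3 (here 5/2
+ κ > 5/2) is to deliver from A, B, C and the strictly subcritical floor (FloorSubcritical, PROVED).
Deciding theorem (crux-only, certified rev 10–11): closes (hA hB hC hK) := θ(p_c)² ≤ τ_{p_c}(0, n
e₀) → 0 (Grimmett1999_theta_sq_le_openConn_holds), five lines of logic. The assembly-kind items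
Assembly / Assembly2 / Assembly22 are corollaries of K (assembly_of_crossPinnedPairs_decay,
percolationContinuityZ3_of_tendsto_openConn in Theorems/PercLowPointHalfSpaceAssemblyReduction.lean)
and are no longer hypotheses; θ(p_c) = 0 ⟺ cross-bush term → 0 is PROVED
(percolationContinuityZ3_iff_crossPinnedPairs_decay), so the route literally decides the conjunct
through U.
Lean (X_LP = A ∧ B ∧ C ∧ K over bondPercolation (zdGraph 3) (criticalProbI 3), openConnIn {x | 0 ≤ x
0}, box 3 r, openConn, e = Pi.single 1 1, e₀ = Pi.single 0 1): `BoundaryTwoArmDecay ∧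
TallClusterMassBound ∧ QuantitativeBGN ∧ LowPointBookkeeping` — the decls of the route file; all
four elaborate (planner Sketch.lean rc 0, 2026-08-16).

Rationale: WHY THIS LINE. The only unconditional structural theorem AT p_c(ℤ³) is Barsky–Grimmett–Newman: the
wall cluster U = C_H(0) of a floor point of the half-space H = {x₀ ≥ 0} is a.s. FINITE at p_c
(BarskyGrimmettNewman1991 = GrimmettPercolation1999 Thm (7.35); in tree
BarskyGrimmettNewman1991_Z3_holds). Everything that turns θ(p_c) = 0 into a statement about U is now
PROVED in the tree: the low-point identity τ_p(0,w) = E_p[N_w(U)/|U ∩ ∂H|] for p ≤ p_c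
(lowPointIdentity, stmt-0916), its floor/cross split by horizontal mass transport
(measure_openConn_eq_floor_add_cross), the floor case τ_H(0, n e₀) → 0 (stmt-0914), p_c(ℤ³) < 1/2
for the floor plane (stmt-1337), and the equivalence θ(p_c) = 0 ⟺ E_{p_c}[N^cross_{n e₀}(U)/|U ∩
∂H|] → 0 (percolationContinuityZ3_iff_crossPinnedPairs_decay,
Theorems/PercLowPointHalfSpaceAssemblyReduction.lean). So the conjunct IS a statement about a finite
random object, and the route's uncertainty is exactly four cruxes: A, B, C (boundary exponents of U)
and K (the bush/floor bookkeeping A ∧ B ∧ C ⇒ cross term → 0). WHY THE WALL FORM IS MORE ATTACKABLE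
(the question the deciding crux B raises, since B is heuristically x_h ≥ 1/4, a RATE form of the
conjunct near a wall): (i) precedent — the half-space version of the conjunct is a THEOREM (BGN)
while the bulk one is the open problem; the wall supplies steering without sprinkling, reflections
through planes and FKG supermultiplicativity of wall-rooted connections (used in the landed
wall–axis bound τ_H(0, 2h e₀) ≥ 1/(588² h⁴), p78622) and the wall renewal t_h ≤ p τ_∥ ∗ t_{h−1} with
the rigorous p_c χ₁₁(p_c) ≥ 1; (ii) problem TYPE with a track record — 'conditional (top-shell) mass
of a TALL cluster' is closed wherever a cross-scale input exists: d = 2, Kesten1986 Thm (8) p.372,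
E#(W̃ ∩ S(n)) ≍ n² π_n by RSW + quasi-multiplicativity (with (6): π_{2n} ≥ C₃ π_n, the 2D form of
the route's WallArmLowerRegularity); d ≥ 11 half-space, ChatterjeeHanson2020 (arXiv:1810.03750)
§1.2/Thm 1: 'conditional on a half-space arm to distance n, 0 is connected to order n² vertices on
the top of the side-n half-space box', by mass transport from a boundary vertex + two-point bounds;
(iii) structure only the wall form has: B splits into the two ONE-SIDED halves of criticality
(TopShellOverlap uses only p ≤ p_c — false at p = 1; WallArmLowerRegularity only p ≥ p_c — true at p
= 1, false below p_c), and its hard half is LINEAR in U against a fixed kernel at ONE scale (an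
ℓ²/replica-overlap quantity with a quantified near-miss: the PSD connectivity-matrix bound misses by
n^{1/2}). Honest limit: d = 3 has neither RSW nor two-point bounds; the bet is that the wall-rooted
one-scale ℓ² statement is the weakest quantitative form in which a θ(p_c) > 0 world can be excluded
and the first place a future same-p tool bites. Areas imported: mass transport / re-rooting
(LyonsPeres2016 §8.2), boundary critical exponents of 3D percolation (DengBlote2005 numerics;
exponent table book:christensennd-complexity-criticality Table 1.2), beyond-BK arm counting
(Cerf2015, VandenbergVanengelenburg2022), relative-entropy parameter transfer
(Hutchcroft2022Triangle Thm 1.3, for C), decision-tree three-point bounds + Paley–Zygmund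
(Gladkov2024, for WallArmLowerRegularity).
RANKED CRUXES. Four cruxes, all typed and elaborating; `closes (hA hB hC hK)` is crux-only (rev
10–11). CRUX OF RECORD = B (ledger rank 3; A carries rank 2 for historical reasons — three reviews
and this pass rank B first).
 B TallClusterMassBound (stmt-0912): E[|U ∩ B_r| ; U r-tall] ≤ C r^{11/4} π_s(r), m ≤ 11/4 (real
world m = d_f = 2.523(6), margin 0.227; a θ(p_c) > 0 world has finite but DENSE wall clusters, m = 3
— by the saturation argument A, C, the identity and K are all consistent with a jump world, so B
alone separates the worlds). Dictionary (heuristic, hyperscaling): B ⟺ x_h ≥ 1/4 ⟺ η ≥ −1/2 ⟺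
Σ_{Λ_r} τ ≲ r^{5/2}. EXCHANGE RATE (kernel-checked,
Cruxes/TallClusterMassBound/Lines/replica-overlap-cs-transfer.lean,
massBoundAt_of_topShell_of_regularity, axioms standard): B ⟸ TopShellOverlap ∧
WallArmLowerRegularity (shell-wise Cauchy–Schwarz; see TWO-LAYER PLAN); also CSB ⟹ B, TSB ⟹ CSB, (T)
⟹ B proved there. DISPROOF CONSTRAINTS (Theorems/TallClusterMassBound/Negative/*, p73166 p74622
p79226 p77181): exponent 3 holds for every p; B is FALSE at p = 1
(tallClusterMassBound_false_without_criticality — any proof uses p ≤ p_c quantitatively); the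
uniform density version is refuted (root has density 1); m ≥ 1 rigorously; the 2D transplant (d −
1/4) is false (91/48 > 7/4), so a proof must be d = 3-specific. ENGINES CALIBRATED DEAD
(Findings-ideator2.md §2, numbers not adjectives): KL parameter transfer (needs γ₁ ≤ 1.18 vs 1.36),
KL + Markov on volume (certifies δ⁺ ≈ 9.7 only; spatial truncation lost), surface KL (premise x_s⁺ ≤
0.88 false), long-range deformation (constant 1/ε), Young on the wall renewal (loses r²), PSD block
inequality (Σ τ_H² ≤ C r χ₁₁(4r), misses n^{1/2} — the closest), BK shell-peeling / wall–bulk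
factorisation (reduces to the bulk quarter-arm = summit costume), slab truncation, expectation
recursion (vacuous by p_c χ₁₁ ≥ 1), BK-decoupled blobs (tree-graph loss), packing + thin footprint
(impossible: a ≤ x_s), annulus-product criterion (= the missing same-p criterion), AKN/GGR/Cerf
two-arm (counts clusters, not density). MC (kit j010987, drefute): conditional shell-mass slope →
2.51 (d_f ✓, threshold 2.75 ✓). Why it might fail: in the item.
 A BoundaryTwoArmDecay (stmt-0911): P(two DISJOINT r-tall wall clusters from the adjacent floor
roots 0, e) ≤ C r^{−5/2−κ}. BK/Reimer gives 2x_s ≈ 1.95 and presupposes C; the saturation argument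
FORCES a₂ = d = 3 in both worlds (2D instance: half-plane 3-arm exponent β₃ = 2, Nolin2008 Thm 23),
so the true margin over 5/2 is 1/2; MC a₂ local slopes 2.10 → 2.94 (kit j008695, fit 2.91 on
[12,24]; rreview j000789: 3.04 on [8,32]). Ideator map
(Cruxes/BoundaryTwoArmDecay/FindingsIdeator1.md): of four non-circular skeletons only BK + repulsion
clears 5/2 with dream inputs (needs C at a₁ ≥ 0.73 plus repulsion λ ≥ 0.55); two BK-free counting
levers are in triage — merge-forest level bridges (exact bridge identity p_c P(E_r) = (1 − p_c)
P(LB_r); a₂ ≥ 3 − growth exponent of E[D·N], D = # disjoint macroscopic pieces) and the staple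
census (P(A^v_n) ≤ (m₀/p_c³) e_n with Σ_n e_n ≤ 1 from BGN; MC j008695: (M+S)/B = 0.90–0.98).
Disproof (Theorems/BoundaryTwoArmDecay/Negative): the disjointness clause and r ≥ 1 are
load-bearing; dropping disjointness gives ≥ p_c/(36(2r+3)²).
 C QuantitativeBGN (stmt-0913): π_s(r) ≤ C r^{−a} for SOME a > 0 (window 0 < a ≤ 2 by the landed
floor π_s(n) ≥ 1/(36(2n+1)²); numerics a = x_s ≈ 0.975). PICKED LINE
kl-surface-susceptibility-transfer (lead prover-line-stmt-0913-0): a = 1 − γ₁/2 from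
Hutchcroft2022Triangle Thm 1.3 (relative-entropy transfer on the induced half-space graph, max
degree 6) + Markov; two of three stubs LANDED (Theorems/…QuantitativeBGNArmToSurfaceTail.lean,
…KlSurfaceTail.lean), ONE open stub: γ₁ < 2 for the SUBCRITICAL surface susceptibility χ_H(p) ≤ C
(p_c − p)^{−γ₁} (a p < p_c statement; numerics γ₁ ≈ 1.36, false in d = 2, true in d > 6).
 K LowPointBookkeeping (stmt-14713, filed by this pass): A → B → C → [P_{p_c}(0 ↔ n e₀) → 0 along
the normal axis]; given the proved identity, floor split and floor case this is EXACTLY 'A ∧ B ∧ C ⇒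
cross-bush term → 0' (= the rchoice seat's CrossBushBookkeeping in τ-form; its conclusion alone ⟺
the conjunct, so only a proof THROUGH A, B, C and the bush/floor structure is informative). Content:
cross pinned pairs lie in different bushes of U glued through the strictly subcritical floor
(FloorSubcritical + perc_sharpness_holds d = 2); dyadic sum C Σ_k 2^{k(2m−3−a₂)} with 2m − 3 = 5/2 <
5/2 + κ. MC (rreview j001444/j001445, R ≤ 48, L ≤ 6): direct adjacent-root pair fraction 0.92–0.95,
root separation 1.4–1.8; bush-disjoint event has A's exponent.
 ASSEMBLY ITEMS (operator to-do, unchanged from rev 8): Assembly (stmt-0915, A → B → C →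
PercolationContinuityZ3), 'Assembly2' (stmt-14687 := FloorSubcritical → Assembly, a neutralised
duplicate) and 'Assembly22' (stmt-1722) are NOT hypotheses of `closes` any more; each follows from K
in one line (assembly_of_crossPinnedPairs_decay / percolationContinuityZ3_of_tendsto_openConn); the
gate's route.multi-assembly stamp needs an OPERATOR re-kind/delete of 14687 and 1722 (every planner
item-level verb bounces 'would violate D-0019 — 3 assembly items').
TWO-LAYER PLAN. (1) B ⇐ TopShellOverlap → WallArmLowerRegularity → B, the only line that passed crux
triage (3/3), glue kernel-checked, both children registered as stubs on stmt-0912, three line leads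
(-0/ -1/ -2) and drefute/cdisprove concur they are item-sized; to be filed with `route edit --split
TallClusterMassBound` as soon as item-level edits pass again (children.json with why/sources in the
promote planner's folder). TopShellOverlap (hardest item of the route; uses p ≤ p_c only): ∃ C ∀ n ≥
1, Σ_{x ∈ B_n∖B_{⌊n/2⌋}} P(0 ↔_H x ∧ arm_H(0,n))² ≤ C n^{5/2} π_s(n)² — the expected overlap on the
top shell of two INDEPENDENT n-tall wall clusters; heuristic n^{3−2x_h} = n^{2.05} vs allowed
n^{2.5} (margin 0.45); MC kit j010987: S1(n) = LHS/(n^{5/2}π_s²) = 0.203, 0.144, 0.109, 0.078, 0.058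
(n = 4…64, slope −0.41…−0.49); rigorous window: exponent 3 free, < −1 refuted (p79226).
WallArmLowerRegularity (uses p ≥ p_c only): ∃ C, λ < 11/4 ∀ 1 ≤ n ≤ r, π_s(n) ≤ C (r/n)^λ π_s(r);
PROVED equivalent (p82448) to a uniform 2^k-fold extension bound with constant > 2^{−11k/4} for one
k — k = 1: 'an n-tall wall cluster is 2n-tall with conditional probability ≥ 0.149' (MC 0.51–0.59 ≈
2^{−x_s}); landed slices: n ≤ N₀ and r ≥ n^{λ/(λ−2)} (p77969 window reduction), one-scale floors
π_s(r) ≥ 1/(588 r²) and π(a)·π_s(a) ≥ 1/(5292 a²) (p81863), doubling > q infinitely often for every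
q < 1/4 (p78617), λ > 0 forced (p77181); live handles: Paley–Zygmund + Gladkov's three-point bound
(gladkov2024_thm_6_2_holds, proved) turning doubling into susceptibility-increment regularity, or
any LOSSY fixed-p 3D gluing with per-scale constant > 0.149 (the obvious RSW proof meets
TransverseCrossingsNeedNotMeet; the margin ×3.5 per doubling is the bet). (2) K ⇐ (adjacent-root
dyadic lemma: A × B / footprint) → (chain/far-root summability: FloorSubcritical + sharpness + C) →
(second floor mass transport E[N^cross_L/|U ∩ ∂H|] = E[M_L(0)]) → K, once a prover proposes the cut.
KILL CRITERIA. (i) A: measured a₂ < 5/2 (kit, R ≥ 96) or a printed 3D boundary two-cluster exponent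
< 5/2 retires A as stated (restate only if a₂ > 2m_true − 3 survives; with a₂ = 3 forced the slack
is 0.48). (ii) B: m_eff ≥ 11/4 at large r retires B; per child — S1(n) INCREASING at large n kills
TopShellOverlap, a doubling ratio π_s(2n)/π_s(n) → below 0.149 kills WallArmLowerRegularity
(measured 0.52, flat). (iii) K: a refuter showing the bookkeeping needs a₂ > 3 (bush chains
dominant) or that far-root/chain terms are not summable under A ∧ B ∧ C ∧ FloorSubcritical forces an
explicit extra input (footprint lower bound or boundary quasi-multiplicativity) or collapses the
route onto B; empirical warning = direct-vs-chain pair fraction falling with L (0.92–0.95 at L ≤ 6).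
(iv) C cannot be refuted in the real world short of θ_H(p_c) > 0; γ₁ ≥ 2 would kill its picked LINE,
not C. (v) A model-blind proof of B or TopShellOverlap is impossible (false at p = 1, false for d =
2): a proposed proof not using d = 3 and p ≤ p_c quantitatively is wrong — cheap refuter test.
NOT DECOMPOSED YET. The inside of K (second floor mass transport, adjacent-root dyadic lemma, chain
summability — needs bush/root definitions); an engine for TopShellOverlap (none known: thirteen
calibrated dead, see B); the multi-scale gluing or PZ–Gladkov argument for WallArmLowerRegularity;
the counting lever for A (merge-forest / staple census, in crux triage); C's open stub γ₁ < 2. No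
third layer will be filed (D-0019); lemmas below the children ride as `--supports`.
CHEAPEST FALSIFIER. Already run (kit j010987, drefute, p = 0.24881182, n ≤ 64, 2500 tall
samples/scale): S1(n) decreasing 0.203 → 0.058 (stub 1 holds with C ≈ 0.2), doubling ratios flat at
1.97 ≈ 2^{x_s} against the lethal 6.73, shell-mass slope 2.51 < 2.75, π_s slope −0.94…−1.02; j008695
(A): a₂ fit 2.91 on [12,24] rising. Next cheapest (one kit job, existing scripts mc/stubcheck.py +
mc_census.py): push S1(n) and the a₂ slope to n = 128 with 10⁴ tall samples; a turn-up of S1 or an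
a₂ plateau below 2.6 is the first real warning. Lookup falsifier: any printed η(3) < −1/2 or d_f(3)
> 2.75 (all tables: η ≈ −0.05, d_f = 2.523(6)).
NUMBERS. d_f = 2.523(6), γ = 1.793(3), ν = 0.8765(16), β = 0.4181(8)
(book:christensennd-complexity-criticality Table 1.2, held, PDF p.63); x_h = 3 − d_f = 0.477; x_s ≈
0.975 and γ₁ ≈ 1.36 (DengBlote2005 — NOT held, acq-01316 open; corroborated by in-project MC π_s
slopes −0.94…−1.02, j010987/j000789); margins: B 0.227, TopShellOverlap 0.45, WallArmLowerRegularity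
1.77 (×3.5 per doubling in probability), A 0.5 below the forced a₂ = 3, C any a ∈ (0, 2]. High-d
contrast (why every d = 3 mechanism here must be d-specific): half-space one-arm ≍ n^{−3}, boundary
arms decouple, a₂ = 6 = 2x_s (ChatterjeeHanson2020 Thm 1(a); SpanningClustersAboveSix).
SUPPORT. Proved items: HalfSpaceAxisDecay (stmt-0914), LowPointIdentity (stmt-0916),
FloorSubcritical (stmt-1337). Landed around the cruxes (all sorry-free, --supports): B —
Negative/MassExponentFamily, FalseWithoutCriticality, TopShellOverlapFloor, WallArmExponentPos;
WallArmPartial (p77969), OverlapSandwich (p78007), WallArmDoublingIO (p78617), WallAxisTwoPoint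
(p78622), BulkWallArmProduct (p81863), WallArmLowerRegularity ⟺ PowExtension (p82448); A —
Negative/LoadBearing, OneArmLowerBound; C — QuantitativeBGNArmToSurfaceTail,
QuantitativeBGNKlSurfaceTail; assembly side — AssemblyReduction (p82091), Assembly2Glue (p81971),
AssemblyFloorTransport, LowPointIdentity(+Shift), HalfSpaceAxisDecay, FloorSubcritical.

Novelty: Searches (2026-08-15/16, five seats): card + three refuter route reviews (zbMATH 'percolation
half-space critical exponents', 'half-space two-point function boundary exponent': 0 relevant;
CH2020 full-text grep lowest|extremal: none; crossref/galaxy for a printed 3D boundary two-cluster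
exponent: none); grounder g14-0 (lit search --hybrid 'half-space percolation critical one-arm
quantitative', lit vsearch, galaxy 'percolation in half-spaces': textbooks / 3 unrelated); crux
ideators (galaxy pdf bm25 'rigorous bounds boundary one-arm exponent surface susceptibility
percolation half-space three dimensions': 10 hits none rigorous; 'overlap of two independent
percolation clusters' 0; KozmaNitzan2024 pp.1–4,15–18,37–38, Cerf2015 pp.2–4, Hutchcroft
arXiv:2008.11197 §2 and arXiv:2202.07634 pp.4–5 read); this pass: lit galaxy search --star all
'percolation in half-spaces' (3: brochette percolation, a UFMG thesis, ALEA slab defects —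
unrelated), 'overlap of two independent critical percolation clusters' (0), 'surface critical
behaviour of percolation' (0), galaxy pdf bm25 on surface exponents / wall-attached cluster mass /
half-space one-arm (15 hits: Galvani SISSA thesis on bounded critical phenomena (CFT, not
percolation rigour), Fortunato–Aharony spanning clusters in high d, unrelated condensed-matter), lit
search --hybrid 'critical percolation half-space boundary one-arm exponent three dimensions cluster
fractal dimension wall' (12 textbooks), page reads Kesten1986 p.372 ((6) π_{2n  [refs: 10.1007/bf01321136, 10.1007/bf00776239, 10.1103/PhysRevE.71.016117, 2008.11197, 2202.07634, 1810.03750, 2410.03647, 2106.06400, book:christensennd-complexity-criticality, doi:10.1007/bf01321136, doi:10.1007/bf00776239, doi:10.1103/PhysRevE.71.016117, KozmaNitzan2024, Cerf2015, Kesten1986, ChatterjeeHanson2020, Nolin2008, DengBlote2005, BarskyGrimmettNewman1991, GrimmettPercolation1999]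

Barriers (technique_class: lowpoint-identity halfspace-cluster boundary-arms MTP l2): - technique_class: lowpoint-identity halfspace-cluster boundary-arms MTP;
second-moment/replica-overlap (shell-wise Cauchy–Schwarz); wall-arm regularity; KL parameter
transfer (crux C line)
- Literature.Barriers.CriticalPhenomena.SprinklingRenormalisation: evaded in form — nothing is
renormalised and no parameter moves in A, B, K; the identity and all cruxes live AT p_c(ℤ³). Its
substance (information acquired by explorations is negative) reappears honestly inside A (repulsion
of two clusters at a common root) in BGN's own half-space setting; C's picked line moves p (KL
transfer from p < p_c) but pays the explicit entropy price kl(p‖p_c)·χ_H(p), no sprinkling lemma.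
- Literature.Barriers.CriticalPhenomena.SlabLimitUniformControl: not engaged — no slab limit k → ∞
and no uniform modulus; the half-space is used at p_c(ℤ³) directly (BGN proved in tree);
WallArmLowerRegularity is a same-p cross-scale statement, not a p-uniform one.
- Literature.Barriers.CriticalPhenomena.TransverseCrossingsNeedNotMeet: (i) A — applies in spirit
(two 3D clusters need not meet); evasion claimed only for clusters rooted at ADJACENT floor points
(2d_f − d ≈ 2.05 > 0: they meet generically), and the two counting levers in triage (merge-forest
bridges, staple census) use no intersection of crossings at all; (ii) WallArmLowerRegularity — it
DOES bite the obvious RSW/FKG proof (glue an n-arm to an annulus crossing = the vertex-intersection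
step the Narrow form kills in a thick box); the bet is the size o

Novelty grade: new-combination — ROUTE REVIEW gen-2 = 3rd independent recheck (refuter rreview-1c01669c-g2; gen-0/grounder/gen-1 stand); re-filed to correct kit job ids, verdict unchanged from 14:47Z. KEEP OPEN; new-combination (concur); not a recombination (negatives: none of this route's statements). W1 rc0 7/7; Assembly2 ↔ (Floo (refuter refuter-rreview-route-CriticalPhenomena--1c01669c-g2-0, 2026-08-15T21:00:56Z; prior: BarskyGrimmettNewman1991 = Grimmett1999 Thm (7.35) (θ_ℍ(p_c)=0, in tree), LyonsPeres2016 §8.2 (MTP re-rooting); Hammersley–Welsh / Madras–Slade §3.1 (extremal-coordinate split), arXiv:1810.03750 Chatterjee–Hanson 2020 (half-space arms via MTP, d>6), arXiv:1306.3105 Cerf 2015; VandenbergVanengelenburg2022 (beyond-BK two-arm counting, bulk), doi:10.1103/PhysRevE.71.016117 Deng–Blöte 2005 (x_s ≈ 0.97)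

History (route lifecycle, newest last):
- 2026-08-16T14:15:59Z · LINT AUTOFIX: dropped duplicate assembly item(s) Assembly2, Assembly22 (kept the one `closes` uses) (operator:gate4)

sub-problem: PercolationContinuityZ3 · status: open · opened planner-plancards-CriticalPhenomena-PercolationContinuityZ3-20260815w1-1-0 2026-08-15T10:35:17Z · rev 18 · ledger route-CriticalPhenomena-PercLowPointHalfSpace
GENERATED by the gate from the ledger (D-0016/17). Provers cite these decls: `theorem foo : Summit.CriticalPhenomena.PercolationContinuityZ3.Theses.PercLowPointHalfSpace.<Decl> := …` in Summits/CriticalPhenomena/PercolationContinuityZ3/Theorems/<Name>.lean.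
-/

namespace Summit.CriticalPhenomena.PercolationContinuityZ3.Theses.PercLowPointHalfSpace

open scoped BigOperators Topology Manifold Classical MeasureTheory ProbabilityTheory Matrix InnerProductSpace ComplexConjugate ContinuousMap
open Filter Set Function TopologicalSpace MeasureTheory

attribute [summit_statement] _root_.PercolationContinuityZ3

/-- item stmt-CriticalPhenomena-0911 · crux · rank 2 · open · by planner
why it might fail: Needs a rate CREATED at p_c(ℤ³): BK/Reimer gives 2x_s ≈ 1.95 and presupposes C; saturation forces a₂ = d = 3 (MC 2.9–3.1), so the true slack over 5/2 is 1/2; the BK-free counting levers (merge-forest bridges, staple census) still need an RSW-lite 'O(polylog) disjoint tall pieces' input.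
sources: Cerf2015, VandenbergVanengelenburg2022, Nolin2008, BarskyGrimmettNewman1991, ChatterjeeHanson2020, KozmaNitzan2024
[crux] r2 (A): boundary two-arm repulsion beyond BK. At p_c(Z^3), with H = {x_0 >= 0} and e =
(0,1,0): P(C_H(0) and C_H(e) are disjoint [0 not joined to e in H] and both reach sup-distance >= r)
<= C r^{-5/2-kappa} for some kappa > 0. BK/Reimer + numerics give only exponent ~2 x 0.975 = 1.95;
the card's bookkeeping predicts a_2 = d = 3 (2D sanity check: half-plane 3-arm exponent 2);
in-session MC slope 2.81 at r <= 16 (indicative). Threshold 5/2 chosen so that with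
TallClusterMassBound (m = 11/4) the glue inequality a_2 > 2m - 3 = 5/2 closes. Sources: card
lowpoint-identity-halfspace-pinned-pairs; Cerf2015 (arXiv:1306.3105) and
VandenbergVanengelenburg2022 for bulk two-arm counting beyond BK; BarskyGrimmettNewman1991. -/
@[route_item "route-CriticalPhenomena-PercLowPointHalfSpace"]
def BoundaryTwoArmDecay : Prop :=
  ∃ κ C : ℝ, 0 < κ ∧ ∀ r : ℕ, 1 ≤ r → (Literature.Probability.Percolation.bondPercolation (Literature.Probability.LatticeModels.zdGraph 3) (Literature.Probability.Percolation.criticalProbI 3)).real {ω | (∃ y : Literature.Probability.LatticeModels.Site 3, (∃ i : Fin 3, (r : ℤ) ≤ |y i|) ∧ ω ∈ Literature.Probability.Percolation.openConnIn {x : Literature.Probability.LatticeModels.Site 3 | 0 ≤ x 0} 0 y) ∧ (∃ y : Literature.Probability.LatticeModels.Site 3, (∃ i : Fin 3, (r : ℤ) ≤ |y i - (Pi.single 1 1 : Literature.Probability.LatticeModels.Site 3) i|) ∧ ω ∈ Literature.Probability.Percolation.openConnIn {x : Literature.Probability.LatticeModels.Site 3 | 0 ≤ x 0} (Pi.single 1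 1 : Literature.Probability.LatticeModels.Site 3) y) ∧ ω ∉ Literature.Probability.Percolation.openConnIn {x : Literature.Probability.LatticeModels.Site 3 | 0 ≤ x 0} 0 (Pi.single 1 1 : Literature.Probability.LatticeModels.Site 3)} ≤ C * (r : ℝ) ^ (-(5 / 2 + κ))

/-- item stmt-CriticalPhenomena-0912 · crux · rank 3 · open · by planner
why it might fail: Heuristically B ⟺ x_h ≥ 1/4 (one-arm RATE near the wall; real world x_h = 3−d_f = 0.477, margin 0.227) — stronger than the conjunct, violated only by a jump world with dense wall clusters; false at p=1 and for the d=2 analogue, so a proof must use d=3 AND p≤p_c quantitatively; 13 engines dead.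
sources: BarskyGrimmettNewman1991, GrimmettPercolation1999, HeydenreichVanDerHofstad2017, Kesten1986, ChatterjeeHanson2020, book:christensennd-complexity-criticality
[crux] r3 (B): tall critical half-space clusters are thin. At p_c(Z^3): E[|C_H(0) ∩ B_r| ; C_H(0)
reaches sup-distance r] <= C r^{11/4} P(C_H(0) reaches sup-distance r), i.e. conditional mass
exponent m <= 11/4 < 3 (expected m = d_f ~ 2.523; a jump world theta(p_c) > 0 has finite but DENSE
half-space clusters, m = 3 — this is where the absurd world must be killed). Written as a sum over x
in box 3 r of P(0 <->_H x, arm_H(0,r)). Tools: BGN finiteness (in tree) + isoperimetry of Z^3 +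
AKN-type counting of boundary-touching clusters. Sources: card; Grimmett1999 Thm (7.35);
HeydenreichVanDerHofstad2017 (1.2.13) for mass ~ r^{2-eta} heuristics. -/
@[route_item "route-CriticalPhenomena-PercLowPointHalfSpace"]
def TallClusterMassBound : Prop :=
  ∃ C : ℝ, ∀ r : ℕ, 1 ≤ r → ∑ x ∈ Literature.Probability.LatticeModels.box 3 r, (Literature.Probability.Percolation.bondPercolation (Literature.Probability.LatticeModels.zdGraph 3) (Literature.Probability.Percolation.criticalProbI 3)).real (Literature.Probability.Percolation.openConnIn {x : Literature.Probability.LatticeModels.Site 3 | 0 ≤ x 0} 0 x ∩ {ω | ∃ y : Literature.Probability.LatticeModels.Site 3, (∃ i : Fin 3, (r : ℤ) ≤ |y i|) ∧ ω ∈ Literature.Probability.Percolation.openConnIn {x : Literature.Probability.LatticeModels.Site 3 | 0 ≤ x 0} 0 y}) ≤ C * (r : ℝ) ^ ((11 : ℝ) / 4) * (Literature.Probability.Percolation.bondPercolation (Literature.Probability.LatticeModels.zdGraph 3) (Literature.Probability.Percolation.criticalProbI 3)).real {ω | ∃ y : Literature.Probability.LatticeModels.Site 3, (∃ i : Fin 3,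 (r : ℤ) ≤ |y i|) ∧ ω ∈ Literature.Probability.Percolation.openConnIn {x : Literature.Probability.LatticeModels.Site 3 | 0 ≤ x 0} 0 y}

/-- item stmt-CriticalPhenomena-0913 · crux · rank 4 · open · by planner
why it might fail: BGN is qualitative (finite-size criterion by contradiction), no rate in print for d=3; the picked KL line gives a = 1 − γ₁/2 only if the SUBCRITICAL surface susceptibility has γ₁ < 2 (numerics 1.36; false in d=2, true in d>6) — a mean-field-type bound at p<p_c that is itself open in d=3.
sources: GrimmettPercolation1999, BarskyGrimmettNewman1991, Hutchcroft2022Triangle, ChatterjeeHanson2020, KozmaNitzan2024, DuminilCopinTassionEM2016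
[crux] r4 (C): quantitative Barsky-Grimmett-Newman. At p_c(Z^3) the boundary one-arm probability
P(C_H(0) reaches sup-distance >= r) <= C r^{-a} for SOME a > 0 (numerically a = x_s ~ 0.975,
Deng-Blote 2005). BGN's theta_H(p_c) = 0 (proved in tree: BarskyGrimmettNewman1991_Z3_holds) is
soft, by contradiction through a finite-size criterion; a rate needs a renewal/multi-scale version
of steering. Publishable alone; wanted in spirit by cards counterfactual-cluster-resistance,
boundary-critical-squeeze, climb-ratio-receding-floor-v2, quarantine-fat-islands (which needs a >
4/5). Sources: Grimmett1999 Thm (7.35) pp.162-169; KozmaNitzan2024 p.2 item 4 (no rate for BGN in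
print); doi:10.1103/PhysRevE.71.016117. -/
@[route_item "route-CriticalPhenomena-PercLowPointHalfSpace"]
def QuantitativeBGN : Prop :=
  ∃ a C : ℝ, 0 < a ∧ ∀ r : ℕ, 1 ≤ r → (Literature.Probability.Percolation.bondPercolation (Literature.Probability.LatticeModels.zdGraph 3) (Literature.Probability.Percolation.criticalProbI 3)).real {ω | ∃ y : Literature.Probability.LatticeModels.Site 3, (∃ i : Fin 3, (r : ℤ) ≤ |y i|) ∧ ω ∈ Literature.Probability.Percolation.openConnIn {x : Literature.Probability.LatticeModels.Site 3 | 0 ≤ x 0} 0 y} ≤ C * (r : ℝ) ^ (-a)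

/-- item stmt-CriticalPhenomena-14713 · crux · rank 5 · closed · proved by Summit.CriticalPhenomena.PercolationContinuityZ3.Theorems.PercLowPointHalfSpaceLowPointBookkeeping.lowPointBookkeeping_proof @ 1922d85d9809 (prover) · by planner
why it might fail: Bounds cross pairs by (adjacent-root disjoint tall pair)×(two bush masses): chains bush–floor–bush–floor–bush and the weight 1/|U∩∂H| (tall-U footprint ≈ r^{2−x_s}, not O(1)) may spoil the dyadic sum; with a₂ = 3 forced by saturation the real margin is κ, not 1/2.
sources: LyonsPeres2016, GrimmettPercolation1999, BarskyGrimmettNewman1991, Summit.CriticalPhenomena.PercolationContinuityZ3.Theorems.percolationContinuityZ3_iff_crossPinnedPairs_decay, kit:j001444, kit:j001445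
[crux] LOW-POINT BOOKKEEPING — the route's step (3), filed as a CRUX so that the deciding theorem is
crux-only (the gen-0 route review asked for exactly this 'BookkeepingLemma as a ranked crux'; the
kind-lock keeps Assembly/Assembly2 as items, and both become COROLLARIES of this one:
Theorems/PercLowPointHalfSpaceAssemblyReduction.lean `assembly_of_crossPinnedPairs_decay`,
`assembly2_of_crossPinnedPairs_decay` with `percolationContinuityZ3_of_tendsto_openConn`).
STATEMENT: A → B → C → [P_{p_c}(0 ↔ n e₀) → 0 as n → ∞] along the normal axis e₀ = Pi.single 0 1.
CONTENT: by the PROVED low-point identity τ_p(0,w) = E_p[N_w(U)/|U ∩ ∂H|] (lowPointIdentity,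
Theorems/PercLowPointHalfSpaceLowPointIdentity.lean), the PROVED floor/cross split P_p(0 ↔ w) =
P_p(0 ↔_H w) + E_p[N^cross_w(U)/|U ∩ ∂H|] (measure_openConn_eq_floor_add_cross,
…AssemblyFloorTransport.lean) and the PROVED floor case P_{p_c}(0 ↔_H n e₀) → 0
(halfSpaceAxisDecay_proof), the conclusion is EQUIVALENT to 'the cross-bush term E_{p_c}[N^cross_{n
e₀}(U)/|U ∩ ∂H|] → 0' (and that to the conjunct:
percolationContinuityZ3_iff_crossPinnedPairs_decay), so the item's entire open content is the card's
exponent bookkeeping: cross pinned p -/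
@[route_item "route-CriticalPhenomena-PercLowPointHalfSpace"]
def LowPointBookkeeping : Prop :=
  BoundaryTwoArmDecay → TallClusterMassBound → QuantitativeBGN → Filter.Tendsto (fun n : ℕ => (Literature.Probability.Percolation.bondPercolation (Literature.Probability.LatticeModels.zdGraph 3) (Literature.Probability.Percolation.criticalProbI 3)).real (Literature.Probability.Percolation.openConn (0 : Literature.Probability.LatticeModels.Site 3) (Pi.single 0 (n : ℤ) : Literature.Probability.LatticeModels.Site 3))) Filter.atTop (nhds 0)

/-- item stmt-CriticalPhenomena-0914 · support · rank 9 · closed · proved by Summit.CriticalPhenomena.PercolationContinuityZ3.Theorems.halfSpaceAxisDecay_proof @ 7ff4def0651d (prover) · by planner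
sources: BarskyGrimmettNewman1991, Grimmett1999
[support] P_{p_c}(0 <->_H L e_0) -> 0 as L -> oo (e_0 = Pi.single 0 1, the normal direction): the 'v
on the floor' case of the low-point bookkeeping. Provable now: C_H(0) is a.s. finite at p_c
(BarskyGrimmettNewman1991_Z3_holds, HalfSpaceProofs.lean), so P(L e_0 ∈ C_H(0)) -> 0 by continuity
of measure / dominated convergence (the events are eventually empty on {C_H(0) finite}). ~40 lines. -/
@[route_item "route-CriticalPhenomena-PercLowPointHalfSpace"]
def HalfSpaceAxisDecay : Prop :=
  Filter.Tendsto (fun n : ℕ => (Literature.Probability.Percolation.bondPercolation (Literature.Probability.LatticeModels.zdGraph 3) (Literature.Probability.Percolation.criticalProbI 3)).real (Literature.Probability.Percolation.openConnIn {x : Literature.Probability.LatticeModels.Site 3 | 0 ≤ x 0} 0 (Pi.single 0 (n : ℤ) : Literature.Probability.LatticeModels.Site 3))) Filter.atTop (nhds 0)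

/-- item stmt-CriticalPhenomena-0916 · support · rank 9 · closed · proved by Summit.CriticalPhenomena.PercolationContinuityZ3.Theorems.lowPointIdentity (prover) · by planner
[support] LOW-POINT IDENTITY (card lowpoint-identity-halfspace-pinned-pairs; re-derived and checked
by the refuter audit): for bond percolation on Z^3 at every p <= p_c and every w with w_0 >= 0,
tau_p(0,w) = E_p[ N_w(U) / |U ∩ ∂H| ], where H = {x_0 >= 0}, U = open cluster of 0 in the induced
half-space graph (a.s. finite for p <= p_c by BarskyGrimmettNewman1991_Z3_holds + monotonicity), ∂H
= {x_0 = 0}, and N_w(U) = #{v ∈ U : v + w ∈ U and (v_0 = 0 or v + w is not joined to v by an open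
path of U inside {x_0 >= 1})} (floor-pinned w-pairs). Proof: l* = max{l : 0 <-> w inside {x_0 >=
l}}; the cluster W of 0 in {x_0 >= l*} touches the floor {x_0 = l*} and equals the half-space
cluster of its lex-min floor point c*; sum over c, translate c to 0, remove the lex-min indicator by
horizontal mass transport (translation invariance of the product measure on the floor Z^2; N_w and
pinnedness are root-invariant, giving the weight 1/|U ∩ ∂H|); w = 0 gives 1, first order in p
checks. To be typed once the definition halfSpacePinnedPairCount (N_w) lands (definition request
filed); target a Theorems file proving it as `theorem lowPointIdentity`. It is step (1) of the
Assembly of this route. Sources -/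
@[route_item "route-CriticalPhenomena-PercLowPointHalfSpace"]
def LowPointIdentity : Prop :=
  ∀ p : unitInterval, p ≤ Literature.Probability.Percolation.criticalProbI 3 → ∀ w : Literature.Probability.LatticeModels.Site 3, 0 ≤ w 0 → (Literature.Probability.Percolation.bondPercolation (Literature.Probability.LatticeModels.zdGraph 3) p) (Literature.Probability.Percolation.openConn 0 w) = ∫⁻ ω, ((Literature.Probability.Percolation.halfSpacePinnedPairCount ω w : ℕ∞) : ENNReal) / ((Literature.Probability.Percolation.halfSpaceFootprint ω : ℕ∞) : ENNReal) ∂(Literature.Probability.Percolation.bondPercolation (Literature.Probability.LatticeModels.zdGraph 3) p)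

/-- item stmt-CriticalPhenomena-1337 · support · rank 9 · closed · proved by Summit.CriticalPhenomena.PercolationContinuityZ3.Theorems.floorSubcritical_proof @ 439d4b92ce02 (prover) · by planner
sources: KestenPTM1982, GrimmettPercolation1999, doi:10.1214/aop/1176993004, doi:10.1017/jpr.2020.111, Literature.Probability.Percolation.kesten_criticalProb_Z2_holds, Literature.Probability.Percolation.perc_sharpness_holds
[support] needs-fact (route repair 2026-08-15; NOT in tree, NOT one of the 11 cone facts):
p_c^bond(Z^3) < 1/2 (= p_c^bond(Z^2), kesten_criticalProb_Z2_holds). The floor plane {x_0 = 0} of H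
carries 2D bond percolation at parameter p_c(Z^3); the Assembly's step (3) ('bushes glued through
exponentially small subcritical floor clusters') needs it STRICTLY subcritical, i.e. this
inequality, after which perc_sharpness_holds (d = 2) gives the exponential floor-cluster tails.
Containment only gives p_c(Z^3) <= 1/2; at equality the floor would be critical 2D percolation
(Harris: a.s. finite clusters, polynomial tails) and the dyadic bookkeeping margin kappa is too thin
for that. The BGN formalisation met the same gap for slabs ((7.38), p_c(S_h) > p_c) and dodged it
with the proved DST slab theorem (HalfSpaceBGNProofs.lean header); no dodge is known for the floor
S_0 = Z^2. Published proofs: KestenPTM1982 §10.2 Example (iii), display after (10.30):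
'p_H(bond-percolation on Z^3) < 1/2 = p_H(G_1)' (Thm 10.3 + Application 3.4(ii));
GrimmettPercolation1999 notes to §1.4, p.30: 'Kesten (1982) proved that p_c(3) < p_c(2)'; van den
Berg / Frieze ladder argument giving p_c(3) <= 0.4798 (the cheape -/
@[route_item "route-CriticalPhenomena-PercLowPointHalfSpace"]
def FloorSubcritical : Prop :=
  Literature.Probability.Percolation.criticalProb (Literature.Probability.LatticeModels.zdGraph 3) (0 : Literature.Probability.LatticeModels.Site 3) < 1 / 2

/-- item stmt-CriticalPhenomena-0915 · assembly · rank 1 · closed · proved by Summit.CriticalPhenomena.PercolationContinuityZ3.Theorems.PercLowPointHalfSpaceAssembly.assembly_proof @ 2565c8a1db7b (prover) · by planner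
sources: BarskyGrimmettNewman1991, LyonsPeres2016, Grimmett1999
[assembly] A -> B -> C -> PercolationContinuityZ3. Proof plan (the card's AssemblyLemma, NOT two
lines): (1) low-point identity tau_{p_c}(0, L e_0) = E[N_{L e_0}(U)/|U ∩ ∂H|] (BGN finiteness +
lowest-level canonicalisation + horizontal mass transport on the i.i.d. floor field); (2) floor case
= HalfSpaceAxisDecay; (3) cross-bush case: pinned pairs lie in different bushes glued through
exponentially small subcritical floor clusters (2D bond percolation at 0.2488 < 1/2, sharpness in
tree); with A (a_2 >= 5/2 + kappa), B (m <= 11/4) and C the dyadic-scale sum is <= C sum_k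
2^{k(2m-3-a_2)} -> tail -> 0 since 2m - 3 = 5/2 < a_2; (4) tau >= theta^2
(Grimmett1999_theta_sq_le_openConn_holds) or percolationContinuity_iff_tendsto_tau restricted to the
axis... NOTE tau -> 0 along ONE sequence suffices: theta^2 <= tau(0, L e_0) -> 0. RISK (why it might
fail): chains of bushes (beta - floor - beta'' - floor - beta') and the footprint normalisation 1/|U
∩ ∂H| may need an extra a-priori input (e.g. a lower bound on the footprint of tall clusters, or
quasi-multiplicativity of boundary arms); if so the tenure planner files it as support or restates
B. Sources: card lowpoint-identity-halfspace-pinne -/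
@[route_item "route-CriticalPhenomena-PercLowPointHalfSpace"]
def Assembly : Prop :=
  (∃ κ C : ℝ, 0 < κ ∧ ∀ r : ℕ, 1 ≤ r → (Literature.Probability.Percolation.bondPercolation (Literature.Probability.LatticeModels.zdGraph 3) (Literature.Probability.Percolation.criticalProbI 3)).real {ω | (∃ y : Literature.Probability.LatticeModels.Site 3, (∃ i : Fin 3, (r : ℤ) ≤ |y i|) ∧ ω ∈ Literature.Probability.Percolation.openConnIn {x : Literature.Probability.LatticeModels.Site 3 | 0 ≤ x 0} 0 y) ∧ (∃ y : Literature.Probability.LatticeModels.Site 3, (∃ i : Fin 3, (r : ℤ) ≤ |y i - (Pi.single 1 1 : Literature.Probability.LatticeModels.Site 3) i|) ∧ ω ∈ Literature.Probability.Percolation.openConnIn {x : Literature.Probability.LatticeModels.Site 3 | 0 ≤ x 0} (Pi.single 1 1 : Literature.Probability.LatticeModels.Site 3) y) ∧ ω ∉ Literature.Probability.Percolation.openConnIn {x : Literature.Probability.LatticeModels.Site 3 | 0 ≤ x 0} 0 (Pi.single 1 1 : Literature.Probability.LatticeModels.Site 3)} ≤ C * (r : ℝ) ^ (-(5 / 2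 + κ))) → (∃ C : ℝ, ∀ r : ℕ, 1 ≤ r → ∑ x ∈ Literature.Probability.LatticeModels.box 3 r, (Literature.Probability.Percolation.bondPercolation (Literature.Probability.LatticeModels.zdGraph 3) (Literature.Probability.Percolation.criticalProbI 3)).real (Literature.Probability.Percolation.openConnIn {x : Literature.Probability.LatticeModels.Site 3 | 0 ≤ x 0} 0 x ∩ {ω | ∃ y : Literature.Probability.LatticeModels.Site 3, (∃ i : Fin 3, (r : ℤ) ≤ |y i|) ∧ ω ∈ Literature.Probability.Percolation.openConnIn {x : Literature.Probability.LatticeModels.Site 3 | 0 ≤ x 0} 0 y}) ≤ C * (r : ℝ) ^ ((11 : ℝ) / 4) * (Literature.Probability.Percolation.bondPercolation (Literature.Probability.LatticeModels.zdGraph 3) (Literature.Probability.Percolation.criticalProbI 3)).real {ω | ∃ y : Literature.Probability.LatticeModels.Site 3, (∃ i : Fin 3, (r : ℤ) ≤ |y i|) ∧ ω ∈ Literature.Probability.Percolation.openConnIn {x : Literature.Probability.LatticeModels.Site 3 | 0 ≤ x 0} 0 y}) → (∃ a C : ℝ, 0 < a ∧ ∀ r : ℕ, 1 ≤ r → (Literature.Probability.Percolation.bondPercolation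 (Literature.Probability.LatticeModels.zdGraph 3) (Literature.Probability.Percolation.criticalProbI 3)).real {ω | ∃ y : Literature.Probability.LatticeModels.Site 3, (∃ i : Fin 3, (r : ℤ) ≤ |y i|) ∧ ω ∈ Literature.Probability.Percolation.openConnIn {x : Literature.Probability.LatticeModels.Site 3 | 0 ≤ x 0} 0 y} ≤ C * (r : ℝ) ^ (-a)) → PercolationContinuityZ3

-- records of items no longer active in this route (dropped / restated):
-- earlier Assembly2 (stmt-CriticalPhenomena-14687, dropped 2026-08-16T14:15:59Z): moot by None — FloorSubcritical → Assembly
-- earlier Assembly22 (stmt-CriticalPhenomena-1722, dropped 2026-08-16T14:15:59Z): moot by None — (Literature.Probability.Percolation.criticalProb (Literature.Probability.LatticeModels.zdGraph 3) (0 : Literature.Probability.LatticeModels.Site 3) < 1 / 2) → (∃ κ C : ℝ, 0 < κ ∧ ∀ r : ℕ, 1 ≤ r → (Literature.Probability.Percolation.bondPercolation (Literature.Probability.LatticeModels.zdGraph 3) (Literat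

/-! D-0027 §2.1 — DECIDING THEOREM (planner-authored via `route open/edit --closes-file`; by planner-promote-CriticalPhenomena-PercLowPoint-d59473e7-0 2026-08-16T06:21:59Z):
its hypotheses are this route's items and its conclusion the sub-problem Statement (glue_lint), and it elaborates with this file. -/

/-- DECIDING THEOREM (D-0027 §2.1), crux-only form (promote pass 2026-08-16, answering `glue.non-crux-hypothesis`):
the three boundary-exponent cruxes A = `BoundaryTwoArmDecay`, B = `TallClusterMassBound`, C = `QuantitativeBGN`
and the bookkeeping crux K = `LowPointBookkeeping` (A → B → C → `P_{p_c}(0 ↔ n e₀) → 0` along the normal axis —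
the route's step (3) with the PROVED low-point identity and floor case folded in) give `θ(p_c(ℤ³)) = 0`:
`θ(p_c)² ≤ τ_{p_c}(0, n e₀)` for every `n` (Grimmett 1999 §8.5, `Grimmett1999_theta_sq_le_openConn_holds`,
sorry-free in tree) and the right side tends to `0`, so `θ(p_c)² ≤ 0`. No assembly/support item is assumed;
`Assembly`/`Assembly2` follow from K by `Theorems.assembly_of_crossPinnedPairs_decay`-type corollaries. -/
@[closes "route-CriticalPhenomena-PercLowPointHalfSpace"] theorem closes (hA : BoundaryTwoArmDecay) (hB : TallClusterMassBound) (hC : QuantitativeBGN)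
    (hK : LowPointBookkeeping) : _root_.PercolationContinuityZ3 := by
  show Literature.Probability.Percolation.theta (Literature.Probability.LatticeModels.zdGraph 3)
      (0 : Literature.Probability.LatticeModels.Site 3) (Literature.Probability.Percolation.criticalProbI 3) = 0
  have h := hK hA hB hC
  have hsq : Literature.Probability.Percolation.theta (Literature.Probability.LatticeModels.zdGraph 3)
      (0 : Literature.Probability.LatticeModels.Site 3) (Literature.Probability.Percolation.criticalProbI 3) ^ 2 ≤ 0 :=
    ge_of_tendsto' h fun n =>
      Literature.Probability.Percolation.Grimmett1999_theta_sq_le_openConn_holds 3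
        (Literature.Probability.Percolation.criticalProbI 3) 0 _
  exact pow_eq_zero_iff two_ne_zero |>.1 (le_antisymm hsq (sq_nonneg _))

end Summit.CriticalPhenomena.PercolationContinuityZ3.Theses.PercLowPointHalfSpace
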